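import Summits.BirchSwinnertonDyer.BirchSwinnertonDyer.Theorems.AdditiveKolyvaginRoadLevelDefs
import Summits.BirchSwinnertonDyer.BirchSwinnertonDyer.Theorems.KolyvaginRoadThreeZhangSupplyLocalConjOrdinary
import HarnessLib

/-!
# Route `AdditiveKolyvaginRoad`, crux `KolyvaginPrimitiveAdditive` (item stmt-BirchSwinnertonDyer-20132):
# stub LOC, towards (Supply) at a general prime `p` — the TORIC condition `toricLocalKer` transports under complex
# conjugation (toric companion of koly3b's `…ZhangSupplyLocalConjOrdinary` §2–§3, ordinary ↦ toric)
# (cell `pub/bsd-wall`, lead prover `bsd-wall-akr-p1` g3; `--supports stmt-BirchSwinnertonDyer-20132`, helper)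

WHY THIS FILE. (Stab) for the signed jump of the GLOBAL half of (Supply) at additive `p` (PORT MAP in
HOME/bsd-wall-akr-p1/NOTES_g3.md, item (d) of the toric list): the relaxed level structure is `conjAct c`-stable; above
the level primes `q ∈ AdmQ` its local condition is the TORIC one, `AdditiveKoly.toricLocalKer` = the tree's
`valuedLocalKer` for the augmentation subgroup `⟨τ • y − y⟩`. The ordinary transport of koly3b (fixed points ↦ fixed
points) becomes: the torsion map `ψ` of a lift `Θ` of a `σ`-semilinear `θ : E ≃+* E'` sends the augmentation subgroup of
`Γ_E` into that of `Γ_{E'}` (`ψ (τ • y − y) = g • ψ y − ψ y` for `τ = Θ⁻¹ g Θ`, and `g ↦ Θ⁻¹ g Θ` is onto).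

WHAT. `conjGalCMH_surjective` (the conjugation `Γ_{E'} → Γ_E` of a lift is onto), `map_mem_augmentationPoints`,
`conjAct_mem_toricLocalKer_of_mem`, `conjAct_mem_toricLocalKer_iff`, `conjAct_mem_toricLocalKer_adicCompletion_iff`.

HONEST FRAMING: theorems only; 0 definitions, 0 named facts, 0 `sorry`; closes nothing.

References: [cite: BertoliniDarmon2005, §2.2–§2.3 (H¹_ord)] [cite: WZhang2014, §4.1] [cite: GrossLMS1991, §5 (5.1)]
[cite: SerreGaloisCohomology1997, I §2.4].
-/

-- single-conjunct summit: `Summit.BirchSwinnertonDyer.BirchSwinnertonDyer.…` repeats the name by design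
set_option linter.dupNamespace false

noncomputable section

open scoped Classical Pointwise

universe u

namespace Summit.BirchSwinnertonDyer.BirchSwinnertonDyer.Theorems.AdditiveKoly

open CategoryTheory WeierstrassCurve Field Function NumberField IsDedekindDomain
open Literature.NumberTheory.EllipticCurves Literature.NumberTheory.Automorphic
open Literature.NumberTheory.GaloisRepresentations
open Summit.BirchSwinnertonDyer.Rank1Residual.X11b.Three.Koly.ZhangSupply.LocalConj

section Transport

variable {K : Type u} [Field K] [CharZero K] (W : WeierstrassCurve ℚ)
variable {E E' : Type u} [Field E] [Algebra K E] [Field E'] [Algebra K E'] [CharZero E] [CharZero E']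

omit [CharZero E] [CharZero E'] in
/-- The conjugation `g ↦ Θ⁻¹ g Θ : Γ_{E'} → Γ_E` of a lift `Θ` of `θ : E ≃+* E'` is onto (`τ = Θ⁻¹ (Θ τ Θ⁻¹) Θ`).
[cite: SerreGaloisCohomology1997, I §2.4] -/
theorem conjGalCMH_surjective {θ : E ≃+* E'} {Θ : AlgebraicClosure E ≃+* AlgebraicClosure E'}
    (hΘ : IsLiftOfRingEquiv θ Θ) : Function.Surjective hΘ.conjGalCMH := by
  intro τ
  refine ⟨hΘ.symm.conjGalHom τ, ?_⟩
  apply AlgEquiv.ext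
  intro x
  change Θ.symm ((show AlgebraicClosure E' ≃ₐ[E'] AlgebraicClosure E' from hΘ.symm.conjGalHom τ) (Θ x)) = _
  rw [IsLiftOfRingEquiv.conjGalHom_apply, RingEquiv.symm_apply_apply, RingEquiv.symm_symm, RingEquiv.symm_apply_apply]

/-- The torsion-level map `ψ` of a lift `Θ` sends the augmentation subgroup `⟨τ • y − y : τ ∈ Γ_E⟩` into the
augmentation subgroup of `Γ_{E'}` (`ψ (Θ⁻¹gΘ • y − y) = g • ψ y − ψ y`, and `g ↦ Θ⁻¹ g Θ` is onto). [folklore] -/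
theorem map_mem_augmentationPoints {θ : E ≃+* E'} {Θ : AlgebraicClosure E ≃+* AlgebraicClosure E'}
    (hΘ : IsLiftOfRingEquiv θ Θ) {n : ℤ}
    (ψ : AddSubgroup.torsionBy (localPoints (W.baseChange K) E) n →+
      AddSubgroup.torsionBy (localPoints (W.baseChange K) E') n)
    (hψ : ∀ P, (ψ P : localPoints (W.baseChange K) E') = localPointsMap (K := K) W Θ P)
    (m : AddSubgroup.torsionBy (localPoints (W.baseChange K) E) n)
    (hm : m ∈ augmentationPoints (absoluteGaloisGroup E) (AddSubgroup.torsionBy (localPoints (W.baseChange K) E) n)) :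
    ψ m ∈ augmentationPoints (absoluteGaloisGroup E') (AddSubgroup.torsionBy (localPoints (W.baseChange K) E') n) := by
  unfold augmentationPoints at hm ⊢
  rw [← AddSubgroup.mem_comap]
  refine (AddSubgroup.closure_le _).mpr (fun m' hm' ↦ ?_) hm
  obtain ⟨τ, y, rfl⟩ := hm'
  obtain ⟨g, rfl⟩ := conjGalCMH_surjective hΘ τ
  rw [SetLike.mem_coe, AddSubgroup.mem_comap, map_sub, smul_of_coe_eq_localPointsMap W hΘ ψ hψ g y]
  exact AddSubgroup.subset_closure ⟨g, ψ y, rfl⟩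

/-- **One direction of the transport of the TORIC condition**: if `s ∈ toricLocalKer E` (its localisation at `E` is
represented by a cocycle valued in the augmentation subgroup) then `σ_* s ∈ toricLocalKer E'` for a `σ`-semilinear
`θ : E ≃+* E'`: `loc_{E'} (σ_* s) = Φ (loc_E s)` (koly3b `transport_torsionLocMap_apply`) and `Φ` preserves valued
classes, the lift's torsion map sending the augmentation subgroup into the augmentation subgroup.
[cite: BertoliniDarmon2005, §2.2–§2.3 (H¹_ord)] [cite: WZhang2014, §4.1] -/
theorem conjAct_mem_toricLocalKer_of_mem (σ : K ≃ₐ[ℚ] K) (θ : E ≃+* E') (hθ : IsSemilinearRingEquiv σ θ)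
    (n : ℤ) {s : galH1Torsion (W.baseChange K) n} (hs : s ∈ toricLocalKer (W.baseChange K) E n) :
    conjAct W σ n s ∈ toricLocalKer (W.baseChange K) E' n := by
  have hΘ : IsLiftOfRingEquiv θ (ringEquivLift θ) := isLiftOfRingEquiv_ringEquivLift θ
  obtain ⟨ψ, hψ⟩ := exists_torsionBy_map (K := K) W (ringEquivLift θ) n
  have h1 := transport_torsionLocMap_apply W σ hθ hΘ n ψ hψ s
  -- unfold the toric condition to «`loc` is a valued class»
  change (W.baseChange K).torsionLocMap E' n (conjAct W σ n s) ∈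
    valuedClasses (G := absoluteGaloisGroup E')
      (augmentationPoints (absoluteGaloisGroup E') (AddSubgroup.torsionBy (localPoints (W.baseChange K) E') n))
  change (W.baseChange K).torsionLocMap E n s ∈
    valuedClasses (G := absoluteGaloisGroup E)
      (augmentationPoints (absoluteGaloisGroup E) (AddSubgroup.torsionBy (localPoints (W.baseChange K) E) n)) at hs
  rw [← h1]
  have h2 := map_mem_valuedClasses hΘ.conjGalCMH ψ (smul_of_coe_eq_localPointsMap W hΘ ψ hψ)
    (fun P hP ↦ map_mem_augmentationPoints W hΘ ψ hψ P hP) hs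
  simpa only [LinearMap.toAddMonoidHom_coe, ContinuousLinearMap.coe_coe] using h2

/-- **The TORIC local condition transports**: `σ_* s ∈ toricLocalKer E' ↔ s ∈ toricLocalKer E` for `σ ∈ Aut(K/ℚ)`
and a `σ`-semilinear `θ : E ≃+* E'` (the converse from `θ⁻¹`, `σ⁻¹` and `σ⁻¹_* σ_* = id`).
[cite: BertoliniDarmon2005, §2.2–§2.3 (H¹_ord)] [cite: GrossLMS1991, §5 (5.1)] -/
theorem conjAct_mem_toricLocalKer_iff (σ : K ≃ₐ[ℚ] K) (θ : E ≃+* E') (hθ : IsSemilinearRingEquiv σ θ) (n : ℤ)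
    (s : galH1Torsion (W.baseChange K) n) :
    conjAct W σ n s ∈ toricLocalKer (W.baseChange K) E' n ↔ s ∈ toricLocalKer (W.baseChange K) E n := by
  refine ⟨fun h ↦ ?_, conjAct_mem_toricLocalKer_of_mem W σ θ hθ n⟩
  have h' := conjAct_mem_toricLocalKer_of_mem (K := K) W σ⁻¹ θ.symm (isSemilinearRingEquiv_symm hθ) n h
  rwa [conjAct_inv_conjAct] at h'

end Transport

section Completion

variable {K : Type} [Field K] [NumberField K] (W : WeierstrassCurve ℚ)

/-- **The toric condition at `v` transports to the toric condition at `σ • v`** (Galois transport of completions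
`galAdicCompletionEquiv`): `σ_* s ∈ toricLocalKer K_{σ•v} ↔ s ∈ toricLocalKer K_v`. At a `σ`-FIXED (inert)
Bertolini–Darmon admissible level prime `q` this is the `τ`-stability of the level-`n` condition `H¹_ord(K_q, E[p])`.
[cite: BertoliniDarmon2005, §2.2–§2.3 (H¹_ord)] [cite: WZhang2014, §4.1] -/
theorem conjAct_mem_toricLocalKer_adicCompletion_iff (σ : K ≃ₐ[ℚ] K) {v v' : HeightOneSpectrum (𝓞 K)}
    (h : σ • v = v') (n : ℤ) (s : galH1Torsion (W.baseChange K) n) :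
    conjAct W σ n s ∈ toricLocalKer (W.baseChange K) (v'.adicCompletion K) n ↔
      s ∈ toricLocalKer (W.baseChange K) (v.adicCompletion K) n := by
  haveI : CharZero (v.adicCompletion K) := charZero_of_injective_algebraMap (algebraMap K _).injective
  haveI : CharZero (v'.adicCompletion K) := charZero_of_injective_algebraMap (algebraMap K _).injective
  exact conjAct_mem_toricLocalKer_iff (K := K) W σ (galAdicCompletionEquiv (L := K) σ h)
    (isSemilinearRingEquiv_galAdicCompletionEquiv σ h) n s

end Completion

end Summit.BirchSwinnertonDyer.BirchSwinnertonDyer.Theorems.AdditiveKoly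

end
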